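import Mathlib
import Summits.Ventures.PercRepro2.Defs
import Summits.Ventures.PercRepro2.Graph
import Summits.Ventures.PercRepro2.Events
import Summits.Ventures.PercRepro2.Harris
import Summits.Ventures.PercRepro2.HCov
import Summits.Ventures.PercRepro2.PendantRoot
import Summits.Ventures.PercRepro2.PendantOB

/-!
# The diagonal `b = a₃` of the covariance form, and `b` a leaf at `a₃`
(blind cell PercRepro2, mine-2 g14; MINE2-CUTVERTEX.md §13.24)

**The diagonal.** With `b := a₃` every `b`-mass of `Gc` collapses onto the `a₃`-world split
`Q = PD ⊔ T ⊔ T′` (`T = Q ∩ {a₃ ∈ C₂}`, `T′ = Q ∩ {a₃ ∈ C₁}`, `PD = Q ∩ {a₃ ∉ U}`): under `Q`,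
`{a₁ ↔ a₃} = T′`, `{a₂ ↔ a₃} = T`, `PD` meets neither, and `Gc p ends o a₁ a₂ a₃ a₃` becomes a
cubic in the nine atoms `D = P(PD)`, `P(T)`, `P(T′)`, `P(T′, oL)`, `P(T′, oH)`, `P(T, oL)`,
`P(T, oH)`, `P(PD, oL)`, `P(PD, oH)` which factors EXACTLY as (`Gc_diag3_eq`)

  `Gc(b = a₃) = 2 (D + 2 P(T)) · M₂ + 2 (D + 2 P(T′)) · M₁`,
  `M₂ = P(T′) P(PD, oH) − D P(T′, oH)`,  `M₁ = P(T) P(PD, oL) − D P(T, oL)`,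

and `M₁ ≥ 0` is exactly the cross-cluster block `CovForm.ToL_mul_D_le` of the margin theorem
(`bhk_cross_cluster_avoid`, BHK06 Thm 1.4), `M₂ ≥ 0` its `a₁ ↔ a₂` mirror. Hence
`Gc_diag3_nonneg : 0 ≤ Gc p ends o a₁ a₂ a₃ a₃` for every weighted graph and all vertices —
the `b = a₃` companion of `HCovDiag` (`o = b`), and the value `Row(1)` of `RowCert` seen from
the `a₃`-side. (Own exact checks: the identity on 72 / 72 random weighted instances, §13.24.)

**The leaf.** `Gc` is linear in the `b`-masses and, for `b` a leaf at `a₃` by the edge `f`,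
every `b`-mass is `p f` times the mass with `b := a₃` (`{x ↔ b} = {f open} ∩ {x ↔ a₃}`,
`PendantRoot.connEvent_other_leaf`); so `Gc(b leaf at a₃) = p f · Gc(b := a₃)`
(`Gc_pendant_b_at_a3`) and (HCOV) holds for `b` a leaf at `a₃` for every leaf weight
(`HCov_pendant_b_at_a3`). Lifted through the one-far-mark equivalence (MINE2-CUTVERTEX.md §12.2)
this closes the instance «`b` alone behind the cut vertex `a₃`» of the LEAD-SEP3 §3 table.
-/

namespace Summit.Ventures.PercRepro2
namespace DiagBA3

open CovForm PendantRoot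

variable {V : Type*} {E : Type*} [Fintype E] [DecidableEq E] [DecidableEq V]
  {R : Type*} [Field R] [LinearOrder R] [IsStrictOrderedRing R]

/-! ## Set identities under `Q` -/

section Sets

variable {ends : E → Sym2 V}

omit [Fintype E] [DecidableEq E] [DecidableEq V] in
/-- `W ∩ {u ↔ v} = W` when every `ω ∈ W` has `u ↔ v`. -/
lemma inter_conn_eq_self {W : Set (Config E)} {u v : V} (hW : ∀ ω ∈ W, Conn ends ω u v) :
    W ∩ connEvent ends u v = W := by
  ext ω
  simp only [Set.mem_inter_iff, mem_connEvent]
  exact ⟨fun h => h.1, fun h => ⟨h, hW ω h⟩⟩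

omit [Fintype E] [DecidableEq E] [DecidableEq V] in
/-- `W ∩ (Y ∩ {u ↔ v}) = W ∩ Y` when every `ω ∈ W` has `u ↔ v`. -/
lemma inter_inter_conn_eq {W Y : Set (Config E)} {u v : V} (hW : ∀ ω ∈ W, Conn ends ω u v) :
    W ∩ (Y ∩ connEvent ends u v) = W ∩ Y := by
  ext ω
  simp only [Set.mem_inter_iff, mem_connEvent]
  exact ⟨fun h => ⟨h.1, h.2.1⟩, fun h => ⟨h.1, h.2, hW ω h.1⟩⟩

omit [Fintype E] [DecidableEq E] [DecidableEq V] in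
/-- `W ∩ {u ↔ v} = ∅` when no `ω ∈ W` has `u ↔ v`. -/
lemma inter_conn_eq_empty {W : Set (Config E)} {u v : V} (hW : ∀ ω ∈ W, ¬ Conn ends ω u v) :
    W ∩ connEvent ends u v = ∅ := by
  ext ω
  simp only [Set.mem_inter_iff, mem_connEvent, Set.mem_empty_iff_false, iff_false, not_and]
  exact hW ω

omit [Fintype E] [DecidableEq E] [DecidableEq V] in
/-- `W ∩ (Y ∩ {u ↔ v}) = ∅` when no `ω ∈ W` has `u ↔ v`. -/
lemma inter_inter_conn_eq_empty {W Y : Set (Config E)} {u v : V}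
    (hW : ∀ ω ∈ W, ¬ Conn ends ω u v) :
    W ∩ (Y ∩ connEvent ends u v) = ∅ := by
  ext ω
  simp only [Set.mem_inter_iff, mem_connEvent, Set.mem_empty_iff_false, iff_false, not_and]
  exact fun h _ => hW ω h

omit [Fintype E] [DecidableEq E] [DecidableEq V] in
/-- `Q ∩ {a₁ ↔ a₃} = T′`. -/
lemma Q_inter_conn13 (ends : E → Sym2 V) (a₁ a₂ a₃ : V) :
    avoidAll ends a₂ {a₁} ∩ connEvent ends a₁ a₃ = TEvent ends a₂ a₁ a₃ := by
  ext ω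
  simp only [Set.mem_inter_iff, mem_connEvent, mem_avoidAll, Finset.mem_singleton, forall_eq,
    TEvent, Set.mem_compl_iff]
  constructor
  · rintro ⟨h21, h13⟩; exact ⟨fun h => h21 (conn_symm h), h13⟩
  · rintro ⟨h12, h13⟩; exact ⟨fun h => h12 (conn_symm h), h13⟩

omit [Fintype E] [DecidableEq E] [DecidableEq V] in
/-- `Q ∩ {a₂ ↔ a₃} = T`. -/
lemma Q_inter_conn23 (ends : E → Sym2 V) (a₁ a₂ a₃ : V) :
    avoidAll ends a₂ {a₁} ∩ connEvent ends a₂ a₃ = TEvent ends a₁ a₂ a₃ := by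
  ext ω
  simp only [Set.mem_inter_iff, mem_connEvent, mem_avoidAll, Finset.mem_singleton, forall_eq,
    TEvent, Set.mem_compl_iff]

omit [Fintype E] [DecidableEq E] [DecidableEq V] in
/-- `Q ∩ (Y ∩ {a₁ ↔ a₃}) = T′ ∩ Y`. -/
lemma Q_inter_inter_conn13 (ends : E → Sym2 V) (a₁ a₂ a₃ : V) (Y : Set (Config E)) :
    avoidAll ends a₂ {a₁} ∩ (Y ∩ connEvent ends a₁ a₃) = TEvent ends a₂ a₁ a₃ ∩ Y := by
  rw [Set.inter_comm Y, ← Set.inter_assoc, Q_inter_conn13]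

omit [Fintype E] [DecidableEq E] [DecidableEq V] in
/-- `Q ∩ (Y ∩ {a₂ ↔ a₃}) = T ∩ Y`. -/
lemma Q_inter_inter_conn23 (ends : E → Sym2 V) (a₁ a₂ a₃ : V) (Y : Set (Config E)) :
    avoidAll ends a₂ {a₁} ∩ (Y ∩ connEvent ends a₂ a₃) = TEvent ends a₁ a₂ a₃ ∩ Y := by
  rw [Set.inter_comm Y, ← Set.inter_assoc, Q_inter_conn23]

end Sets

/-! ## The diagonal identity and its sign -/

/-- **`Gc` on the diagonal `b = a₃`** factors through the two cross-cluster blocks: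
`Gc(b = a₃) = 2 (D + 2 P(T)) · M₂ + 2 (D + 2 P(T′)) · M₁`. -/
theorem Gc_diag3_eq (p : E → R) (ends : E → Sym2 V) (o a₁ a₂ a₃ : V) :
    Gc p ends o a₁ a₂ a₃ a₃ =
      2 * (prob p (PDEvent ends a₁ a₂ a₃) + 2 * prob p (TEvent ends a₁ a₂ a₃)) *
          (prob p (TEvent ends a₂ a₁ a₃) * prob p (PDEvent ends a₁ a₂ a₃ ∩ connEvent ends a₂ o) -
            prob p (PDEvent ends a₁ a₂ a₃) * prob p (TEvent ends a₂ a₁ a₃ ∩ connEvent ends a₂ o)) +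
        2 * (prob p (PDEvent ends a₁ a₂ a₃) + 2 * prob p (TEvent ends a₂ a₁ a₃)) *
          (prob p (TEvent ends a₁ a₂ a₃) * prob p (PDEvent ends a₁ a₂ a₃ ∩ connEvent ends a₁ o) -
            prob p (PDEvent ends a₁ a₂ a₃) * prob p (TEvent ends a₁ a₂ a₃ ∩ connEvent ends a₁ o)) := by
  have hT'13 : ∀ ω ∈ TEvent ends a₂ a₁ a₃, Conn ends ω a₁ a₃ := fun _ h => h.2
  have hT'23 : ∀ ω ∈ TEvent ends a₂ a₁ a₃, ¬ Conn ends ω a₂ a₃ :=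
    fun _ h h23 => h.1 (conn_trans h.2 (conn_symm h23))
  have hT23 : ∀ ω ∈ TEvent ends a₁ a₂ a₃, Conn ends ω a₂ a₃ := fun _ h => h.2
  have hT13 : ∀ ω ∈ TEvent ends a₁ a₂ a₃, ¬ Conn ends ω a₁ a₃ :=
    fun _ h h13 => h.1 (conn_trans h.2 (conn_symm h13))
  have hPD13 : ∀ ω ∈ PDEvent ends a₁ a₂ a₃, ¬ Conn ends ω a₁ a₃ :=
    fun _ h h13 => h.2 (Or.inl (conn_symm h13))
  have hPD23 : ∀ ω ∈ PDEvent ends a₁ a₂ a₃, ¬ Conn ends ω a₂ a₃ :=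
    fun _ h h23 => h.2 (Or.inr (conn_symm h23))
  unfold Gc DEF EQbo EQb3 EQb3o EQo EQ3 EQ3o PDb PDbo Do
  rw [gap_eq_Q]
  simp only [Q_inter_conn13 ends a₁ a₂ a₃, Q_inter_conn23 ends a₁ a₂ a₃,
    Q_inter_inter_conn13 ends a₁ a₂ a₃, Q_inter_inter_conn23 ends a₁ a₂ a₃,
    inter_conn_eq_self hT'13, inter_inter_conn_eq hT'13, inter_conn_eq_empty hT'23,
    inter_inter_conn_eq_empty hT'23, inter_conn_eq_self hT23, inter_inter_conn_eq hT23,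
    inter_conn_eq_empty hT13, inter_inter_conn_eq_empty hT13, inter_conn_eq_empty hPD13,
    inter_inter_conn_eq_empty hPD13, inter_conn_eq_empty hPD23, inter_inter_conn_eq_empty hPD23,
    prob_empty]
  rw [Qsplit_univ p ends a₁ a₂ a₃, Qsplit p ends a₁ a₂ a₃ (connEvent ends a₁ o),
    Qsplit p ends a₁ a₂ a₃ (connEvent ends a₂ o)]
  ring

/-! ## `b` a leaf at `a₃` -/

omit [DecidableEq V] [LinearOrder R] [IsStrictOrderedRing R] in
/-- `P(W ∩ {x ↔ b}) = q · P(W ∩ {x ↔ a₃})` for `b` a leaf at `a₃` and `W` free of `f`. -/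
lemma prob_leaf1 (p : E → R) {ends : E → Sym2 V} {f : E} {b a₃ : V} (hf : ends f = s(b, a₃))
    (hleaf : ∀ e, b ∈ ends e → e = f) (hb3 : b ≠ a₃) {x : V} (hx : b ≠ x) {W : Set (Config E)}
    (hW : Free f W) :
    prob p (W ∩ connEvent ends x b) = p f * prob p (W ∩ connEvent ends x a₃) := by
  rw [connEvent_other_leaf hf hleaf hb3 hx]
  have e : W ∩ (openEdge f ∩ connEvent ends x a₃) = (W ∩ connEvent ends x a₃) ∩ openEdge f := by
    ext ω; simp only [Set.mem_inter_iff]; tauto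
  rw [e, prob_inter_openEdge_of_free p (hW.inter (free_connEvent hf hleaf hb3 (Ne.symm hx) (Ne.symm hb3))),
    mul_comm]

omit [DecidableEq V] [LinearOrder R] [IsStrictOrderedRing R] in
/-- `P(W ∩ (Y ∩ {x ↔ b})) = q · P(W ∩ (Y ∩ {x ↔ a₃}))` for `W`, `Y` free of `f`. -/
lemma prob_leaf2 (p : E → R) {ends : E → Sym2 V} {f : E} {b a₃ : V} (hf : ends f = s(b, a₃))
    (hleaf : ∀ e, b ∈ ends e → e = f) (hb3 : b ≠ a₃) {x : V} (hx : b ≠ x) {W Y : Set (Config E)}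
    (hW : Free f W) (hY : Free f Y) :
    prob p (W ∩ (Y ∩ connEvent ends x b)) = p f * prob p (W ∩ (Y ∩ connEvent ends x a₃)) := by
  rw [connEvent_other_leaf hf hleaf hb3 hx]
  have e : W ∩ (Y ∩ (openEdge f ∩ connEvent ends x a₃)) =
      (W ∩ (Y ∩ connEvent ends x a₃)) ∩ openEdge f := by
    ext ω; simp only [Set.mem_inter_iff]; tauto
  rw [e, prob_inter_openEdge_of_free p
    (hW.inter (hY.inter (free_connEvent hf hleaf hb3 (Ne.symm hx) (Ne.symm hb3)))), mul_comm]

omit [DecidableEq V] in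
/-- **`Gc` with `b` a leaf at `a₃` is `q · Gc(b := a₃)`** (`b`-linearity). -/
theorem Gc_pendant_b_at_a3 (p : E → R) (ends : E → Sym2 V) {f : E} {b a₃ : V}
    (hf : ends f = s(b, a₃)) (hleaf : ∀ e, b ∈ ends e → e = f) (hb3 : b ≠ a₃) {o a₁ a₂ : V}
    (hbo : b ≠ o) (hb1 : b ≠ a₁) (hb2 : b ≠ a₂) :
    Gc p ends o a₁ a₂ a₃ b = p f * Gc p ends o a₁ a₂ a₃ a₃ := by
  have c₁₂ := free_connEvent hf hleaf hb3 (Ne.symm hb1) (Ne.symm hb2)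
  have c₂₁ := free_connEvent hf hleaf hb3 (Ne.symm hb2) (Ne.symm hb1)
  have c₁₃ := free_connEvent hf hleaf hb3 (Ne.symm hb1) (Ne.symm hb3)
  have c₂₃ := free_connEvent hf hleaf hb3 (Ne.symm hb2) (Ne.symm hb3)
  have c₃₁ := free_connEvent hf hleaf hb3 (Ne.symm hb3) (Ne.symm hb1)
  have c₃₂ := free_connEvent hf hleaf hb3 (Ne.symm hb3) (Ne.symm hb2)
  have c₁o := free_connEvent hf hleaf hb3 (Ne.symm hb1) (Ne.symm hbo)
  have c₂o := free_connEvent hf hleaf hb3 (Ne.symm hb2) (Ne.symm hbo)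
  have hQ : Free f (avoidAll ends a₂ {a₁}) := by
    rw [avoidAll_eq_compl]; exact c₁₂.compl
  have hT : Free f (TEvent ends a₁ a₂ a₃) := c₂₁.compl.inter c₂₃
  have hTp : Free f (TEvent ends a₂ a₁ a₃) := c₁₂.compl.inter c₁₃
  have hPD : Free f (PDEvent ends a₁ a₂ a₃) :=
    c₁₂.compl.inter ((PendantOB.free_union c₃₁ c₃₂).compl)
  unfold Gc DEF CovForm.EQbo EQb3 EQb3o EQo EQ3 EQ3o PDb PDbo Do
  rw [gap_eq_Q p ends a₁ a₂ b, gap_eq_Q p ends a₁ a₂ a₃]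
  simp only [
    prob_leaf1 p hf hleaf hb3 hb1 hQ,
    prob_leaf2 p hf hleaf hb3 hb1 hQ c₁o,
    prob_leaf2 p hf hleaf hb3 hb1 hQ c₂o,
    prob_leaf1 p hf hleaf hb3 hb2 hQ,
    prob_leaf2 p hf hleaf hb3 hb2 hQ c₁o,
    prob_leaf2 p hf hleaf hb3 hb2 hQ c₂o,
    prob_leaf1 p hf hleaf hb3 hb1 hPD,
    prob_leaf2 p hf hleaf hb3 hb1 hPD c₁o,
    prob_leaf2 p hf hleaf hb3 hb1 hPD c₂o,
    prob_leaf1 p hf hleaf hb3 hb2 hPD,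
    prob_leaf2 p hf hleaf hb3 hb2 hPD c₁o,
    prob_leaf2 p hf hleaf hb3 hb2 hPD c₂o,
    prob_leaf1 p hf hleaf hb3 hb1 hT,
    prob_leaf2 p hf hleaf hb3 hb1 hT c₁o,
    prob_leaf2 p hf hleaf hb3 hb1 hT c₂o,
    prob_leaf1 p hf hleaf hb3 hb2 hT,
    prob_leaf2 p hf hleaf hb3 hb2 hT c₁o,
    prob_leaf2 p hf hleaf hb3 hb2 hT c₂o,
    prob_leaf1 p hf hleaf hb3 hb1 hTp,
    prob_leaf2 p hf hleaf hb3 hb1 hTp c₁o,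
    prob_leaf2 p hf hleaf hb3 hb1 hTp c₂o,
    prob_leaf1 p hf hleaf hb3 hb2 hTp,
    prob_leaf2 p hf hleaf hb3 hb2 hTp c₁o,
    prob_leaf2 p hf hleaf hb3 hb2 hTp c₂o]
  ring

/-! ## Signs (the cross-cluster blocks need `Fintype V`) -/

section Signs

variable [Fintype V]

/-- The mirror block `M₂ ≥ 0`: `P(T′, oH) · D ≤ P(PD, oH) · P(T′)` (`ToL_mul_D_le` with
`a₁ ↔ a₂`, `PDEvent_symm`). -/
theorem T'oH_mul_D_le (p : E → R) (hp : IsProbVec p) (ends : E → Sym2 V) (o a₁ a₂ a₃ : V) :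
    prob p (TEvent ends a₂ a₁ a₃ ∩ connEvent ends a₂ o) * prob p (PDEvent ends a₁ a₂ a₃) ≤
      prob p (PDEvent ends a₁ a₂ a₃ ∩ connEvent ends a₂ o) * prob p (TEvent ends a₂ a₁ a₃) := by
  have h := ToL_mul_D_le p hp ends o a₂ a₁ a₃
  rwa [PDEvent_symm ends a₁ a₂ a₃] at h

/-- **The diagonal `b = a₃` of (HCOV)**: `0 ≤ Gc p ends o a₁ a₂ a₃ a₃` for every weighted graph and
all vertices (two cross-cluster blocks with nonnegative multipliers). -/
theorem Gc_diag3_nonneg (p : E → R) (hp : IsProbVec p) (ends : E → Sym2 V) (o a₁ a₂ a₃ : V) :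
    0 ≤ Gc p ends o a₁ a₂ a₃ a₃ := by
  rw [Gc_diag3_eq]
  have h1 := ToL_mul_D_le p hp ends o a₁ a₂ a₃
  have h2 := T'oH_mul_D_le p hp ends o a₁ a₂ a₃
  have hD := prob_nonneg hp (PDEvent ends a₁ a₂ a₃)
  have hT := prob_nonneg hp (TEvent ends a₁ a₂ a₃)
  have hT' := prob_nonneg hp (TEvent ends a₂ a₁ a₃)
  have hM1 : 0 ≤ prob p (TEvent ends a₁ a₂ a₃) * prob p (PDEvent ends a₁ a₂ a₃ ∩ connEvent ends a₁ o) -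
      prob p (PDEvent ends a₁ a₂ a₃) * prob p (TEvent ends a₁ a₂ a₃ ∩ connEvent ends a₁ o) := by
    linarith
  have hM2 : 0 ≤ prob p (TEvent ends a₂ a₁ a₃) * prob p (PDEvent ends a₁ a₂ a₃ ∩ connEvent ends a₂ o) -
      prob p (PDEvent ends a₁ a₂ a₃) * prob p (TEvent ends a₂ a₁ a₃ ∩ connEvent ends a₂ o) := by
    linarith
  have hc1 : 0 ≤ 2 * (prob p (PDEvent ends a₁ a₂ a₃) + 2 * prob p (TEvent ends a₁ a₂ a₃)) := by
    linarith
  have hc2 : 0 ≤ 2 * (prob p (PDEvent ends a₁ a₂ a₃) + 2 * prob p (TEvent ends a₂ a₁ a₃)) := by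
    linarith
  exact add_nonneg (mul_nonneg hc1 hM2) (mul_nonneg hc2 hM1)

/-- **(HCOV) on the diagonal `b = a₃`.** -/
theorem HCov_diag3 (p : E → R) (hp : IsProbVec p) (ends : E → Sym2 V) (o a₁ a₂ a₃ : V) :
    HCov p ends o a₁ a₂ a₃ a₃ :=
  Gc_diag3_nonneg p hp ends o a₁ a₂ a₃

/-- **(HCOV) when `b` is a leaf at `a₃`**, for every leaf weight. -/
theorem HCov_pendant_b_at_a3 (p : E → R) (hp : IsProbVec p) (ends : E → Sym2 V) {f : E} {b a₃ : V}
    (hf : ends f = s(b, a₃)) (hleaf : ∀ e, b ∈ ends e → e = f) (hb3 : b ≠ a₃) {o a₁ a₂ : V}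
    (hbo : b ≠ o) (hb1 : b ≠ a₁) (hb2 : b ≠ a₂) : HCov p ends o a₁ a₂ a₃ b := by
  unfold HCov
  rw [Gc_pendant_b_at_a3 p ends hf hleaf hb3 hbo hb1 hb2]
  exact mul_nonneg (hp.nonneg f) (Gc_diag3_nonneg p hp ends o a₁ a₂ a₃)

end Signs

end DiagBA3
end Summit.Ventures.PercRepro2
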